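import Literature.AnabelianGeometry.EtaleTheta.Discharge.Sec2DiscreteRigidityStrong
import Literature.AnabelianGeometry.EtaleTheta.Discharge.Sec2MTESystemNatural

/-!
# [EtTh] §2 discharge: Corollary 2.19 (ii) (discrete rigidity) in its PRINTED shape — every projective
# system of mono-theta environments is isomorphic to a NATURAL one (no compatible-family binder)

Mochizuki, *The Étale Theta Function and its Frobenioid-theoretic Manifestations* [EtTh],
Publ. RIMS 45 (2009), §2, Cor 2.19 (ii) p.64 ("any projective system … is isomorphic to the natural
one"), proof p.66 (locators `p.N` = PDF pages of the PRIMS text; bib key `MochizukiEtTh2009`).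
PROOF-ONLY companion (no `def`, no new named fact; seat abc-iut-w5-d047 gen 4; DAG node
`EtTh:Cor2.19(ii)`) composing two landed files, nothing in them edited or restated:
`Sec2DiscreteRigidityStrong.lean` (seat abc-iut-L2-d1: `ThetaEnvTower.exists_iso_of_systems`,
`exists_iso_of_systems_tempSlim` — rigidity against the natural system of a GIVEN compatible family
`(η₀, hη₀, hη₀c)`) and `Sec2MTESystemNatural.lean` (seat abc-iut-w5-d071:
`ThetaEnvTower.exists_compatible_thetaCocycles` — such a family exists on EVERY tower).

* `ThetaEnvTower.exists_iso_of_system` / `exists_iso_of_system_tempSlim` — the binders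
  `(η₀) (hη₀) (hη₀c)` of the strong discrete rigidity DISCHARGED: modulo exactly the remaining
  (Cor 2.18-type) hypotheses of the cited theorems, every `S : T.MTESystem` is isomorphic, compatibly
  with the transition maps, to the natural system of SOME compatible family of theta cocycles — the
  printed shape of Cor 2.19 (ii).
* `ThetaEnvTower.nonempty_iso_of_systems` — level-wise form: any two projective systems have
  isomorphic mod-`M` members (modulo Cor 2.18 (ii) at level `M`).

HONEST FRAMING: conditional discharge over the typed interface; no side is taken on [IUTchIII]
Cor 3.12; typed ≠ discharged elsewhere.
-/

namespace Literature.AnabelianGeometry.EtaleTheta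

universe u

namespace ThetaEnvTower

variable {E : Set ℕ+} (T : ThetaEnvTower.{u} E)

/-- **Corollary 2.19 (ii), printed shape — DISCHARGED modulo Cor 2.18 (ii), (iii), (iv)** (the
hypotheses of `exists_iso_of_systems`, verbatim): every projective system of mono-theta environments
over `T` is isomorphic, compatibly with the transition maps, to the NATURAL projective system of some
compatible family of theta cocycles. [cite: MochizukiEtTh2009, Cor 2.19(ii) p.64] -/
theorem exists_iso_of_system
    (hslim : ∀ x : T.PiX, (∀ h : T.PiY, x * h * x⁻¹ = h) → x = 1)
    (hq : ∀ M : E, centralizerUnion (T.level M).env =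
      (CycEnvelope.proj (T.level M).augY (T.level M).chi).ker)
    (hlift : ∀ (M : E) (η : T.PiYdd → T.mu M) (hη : η ∈ T.thetaCocycles M) (γ : T.PiX ≃ₜ* T.PiX),
      T.PiY.map γ.toMulEquiv.toMonoidHom = T.PiY →
      ∃ α : ((T.level M).modelMono hη).Iso ((T.level M).modelMono hη),
        ∀ x, ((CycEnvelope.proj (T.level M).augY (T.level M).chi (α.e x) : T.PiY) : T.PiX) =
          γ (CycEnvelope.proj (T.level M).augY (T.level M).chi x : T.PiY))
    (hfib : ∀ (M : E) (η : T.PiYdd → T.mu M) (hη : η ∈ T.thetaCocycles M)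
      (α : ((T.level M).modelMono hη).Iso ((T.level M).modelMono hη)),
      (∀ x, CycEnvelope.proj (T.level M).augY (T.level M).chi (α.e x) =
        CycEnvelope.proj (T.level M).augY (T.level M).chi x) →
      ∃ (φ : T.PiY →* T.mu M) (_ : ∀ g : T.PiYdd, φ ((T.level M).inclYdd g) = 1) (c : T.mu M),
        ∀ x : (T.level M).env, α.e x =
          MulAut.conj (CycEnvelope.inMu (T.level M).augY (T.level M).chi c)
            (CycEnvelope.inMu (T.level M).augY (T.level M).chi
              (φ (CycEnvelope.proj (T.level M).augY (T.level M).chi x)) * x))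
    (hred2 : ∀ (M M' : E) (h : (M : ℕ+) ∣ M') (η₀' η' : T.PiYdd → T.mu M')
      (hη₀' : η₀' ∈ T.thetaCocycles M') (hη' : η' ∈ T.thetaCocycles M')
      (α' : ((T.level M').modelMono hη₀').Iso ((T.level M').modelMono hη')),
      ∃ α : ((T.level M).modelMono (T.red_cocycle_mem M M' h η₀' hη₀')).Iso
          ((T.level M).modelMono (T.red_cocycle_mem M M' h η' hη')),
        T.Reduces h α'.e.toMulEquiv α.e.toMulEquiv)
    (h218ii : ∀ (M : E) (η η' : T.PiYdd → T.mu M) (hη : η ∈ T.thetaCocycles M)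
      (hη' : η' ∈ T.thetaCocycles M),
      Nonempty (((T.level M).modelMono hη).Iso ((T.level M).modelMono hη')))
    (S : T.MTESystem) :
    ∃ (η₀ : ∀ M : E, T.PiYdd → T.mu M) (hη₀ : ∀ M, η₀ M ∈ T.thetaCocycles M),
      (∀ (M M' : E) (h : (M : ℕ+) ∣ M'), T.red M M' h ∘ η₀ M' = η₀ M) ∧
      ∃ α : ∀ M : E, ((T.level M).modelMono (hη₀ M)).Iso ((T.level M).modelMono (S.mem M)),
        ∀ (M M' : E) (h : (M : ℕ+) ∣ M') (x : (T.level M').env),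
          S.a M M' h (T.redEnv M M' h ((α M').e x)) = (α M).e (T.redEnv M M' h x) := by
  obtain ⟨η₀, hη₀, hη₀c⟩ := T.exists_compatible_thetaCocycles
  exact ⟨η₀, hη₀, hη₀c, T.exists_iso_of_systems hslim hq hlift hfib hred2 h218ii S η₀ hη₀ hη₀c⟩

/-- **Corollary 2.19 (ii), printed shape — DISCHARGED modulo temp-slimness of `Π^tp_X`, Kummer
lifting, Cor 2.18 (ii) and the Cor 2.18 (iv) facts** (the hypotheses of
`exists_iso_of_systems_tempSlim`, verbatim): every projective system of mono-theta environments is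
isomorphic, compatibly with the transition maps, to the NATURAL system of some compatible family of
theta cocycles. [cite: MochizukiEtTh2009, Cor 2.19(ii) p.64] -/
theorem exists_iso_of_system_tempSlim
    (hts : ∀ U : Subgroup T.PiX, IsOpen (U : Set T.PiX) →
      ∀ z : T.PiX, (∀ u ∈ U, z * u = u * z) → z = 1)
    (hKL : ∀ (M M' : E) (h : (M : ℕ+) ∣ M') (δ : T.G → T.mu M)
      (hδ : CycEnvelope.IsEnvCocycle (T.level M).augY (T.level M).chi (δ ∘ (T.level M).augY)),
      CycEnvelope.shift hδ ∈ contMulAut (T.level M).env →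
      ∃ (δ' : T.G → T.mu M')
        (hδ' : CycEnvelope.IsEnvCocycle (T.level M').augY (T.level M').chi (δ' ∘ (T.level M').augY)),
        CycEnvelope.shift hδ' ∈ contMulAut (T.level M').env ∧ ∀ g, T.red M M' h (δ' g) = δ g)
    (hlift : ∀ M : E, (T.level M).Cor218_iv_surjective)
    (hfib : ∀ M : E, (T.level M).Cor218_iv_fibre) (h218ii : ∀ M : E, (T.level M).Cor218_ii)
    (S : T.MTESystem) :
    ∃ (η₀ : ∀ M : E, T.PiYdd → T.mu M) (hη₀ : ∀ M, η₀ M ∈ T.thetaCocycles M),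
      (∀ (M M' : E) (h : (M : ℕ+) ∣ M'), T.red M M' h ∘ η₀ M' = η₀ M) ∧
      ∃ α : ∀ M : E, ((T.level M).modelMono (hη₀ M)).Iso ((T.level M).modelMono (S.mem M)),
        ∀ (M M' : E) (h : (M : ℕ+) ∣ M') (x : (T.level M').env),
          S.a M M' h (T.redEnv M M' h ((α M').e x)) = (α M).e (T.redEnv M M' h x) := by
  obtain ⟨η₀, hη₀, hη₀c⟩ := T.exists_compatible_thetaCocycles
  exact ⟨η₀, hη₀, hη₀c, T.exists_iso_of_systems_tempSlim hts hKL hlift hfib h218ii S η₀ hη₀ hη₀c⟩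

/-- **Any two projective systems of mono-theta environments have isomorphic mod-`M` members**
(modulo Cor 2.18 (ii) at level `M`). [cite: MochizukiEtTh2009, Cor 2.19(ii) p.64] -/
theorem nonempty_iso_of_systems {M : E} (h218ii : (T.level M).Cor218_ii) (S S' : T.MTESystem) :
    Nonempty (((T.level M).modelMono (S.mem M)).Iso ((T.level M).modelMono (S'.mem M))) :=
  (h218ii _ _ (S.mem M) (S'.mem M)).elim fun e _ => ⟨e⟩

end ThetaEnvTower

end Literature.AnabelianGeometry.EtaleTheta
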